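import Literature.NumberTheory.QuadraticFields.QuadraticDedekindZeta
import Literature.NumberTheory.QuadraticFields.LatticeSumPrincipal
import Literature.NumberTheory.QuadraticFields.KroneckerSplitting
import Mathlib.NumberTheory.NumberField.ClassNumber
import HarnessLib

set_option linter.dupNamespace false -- `Summit.BirchSwinnertonDyer.BirchSwinnertonDyer.Theorems.…` (summit = sub, D-0017)
set_option autoImplicit false

/-!
# Crux `HeegnerTwistCouplingInSupply` (stmt-BirchSwinnertonDyer-21381), card `genus-doubling-free-box` —
# Oesterlé §1.4 a) AT THE ORDER of a split prime class, and primitive elements of prime-power norm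

Route `BiquadraticEisensteinDescent` (cell `pub/bsd-wall`; width seat `bsd-wall-cm-bed-w4` g25; theorems only,
`--supports 21381`). Kernel form of lever (M) of the crux idea card
`Cruxes/HeegnerTwistCouplingInSupply/Ideas/genus-doubling-free-box.md` («`p ∣ h(d) ⇒ p·lcm(2^{ω−1}, ord[𝔭₂]) ∣ h(d)`»):
what is needed about the ORDER of the class of a prime above a split rational prime.

For a quadratic field `K` (`[K:ℚ] = 2`) and a rational prime `p` that SPLITS in `K` (two primes above `p`, each of
absolute norm `p` — the split data of the tree's `Quadratic.ncard_primesOver_eq_two_iff_jacobiSym` /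
`ncard_primesOver_two_eq_two_iff`, packaged in §1):

* §2 `exists_eq_pow_mul_pow_of_absNorm_eq_pow` — every ideal of norm `p^e` is `𝔭^i 𝔭'^j`, `i + j = e`
  (abstract form of the tree's coordinate version `Quadratic.exists_eq_pow_mul_pow_of_absNorm_eq`);
  `span_natCast_eq_mul` — `(p) = 𝔭𝔭'`.
* §3 ★ `exists_span_singleton_eq_pow` — a PRIMITIVE element of prime-power norm generates a pure prime power:
  `|N(π)| = pⁿ`, `π ∉ p𝓞_K` ⟹ `(π) = 𝔭ⁿ` for one of the two primes `𝔭 ∣ p`; hence `ord[𝔭] ∣ n`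
  (`orderOf_dvd_of_span_singleton_eq_pow`).
* Sequel `…SplitPrimeOrderBound.lean`: Oesterlé 1985 §1.4 a) AT THE ORDER (`|d_K| ≤ 4·p^{ord[𝔭]}`) and the exact
  order `ord[𝔭] = n` when `|d_K| > 4·p^{n−1}`, so `n ∣ h_K` (Nagell / Ankeny–Chowla families `d = x² − 4ℓⁿ`; the card's
  Mersenne family `d = x² − 2ⁿ`, `ord[𝔭₂] = n − 2`).

HONEST FRAMING: class-group bookkeeping for the `h`-side certificate of a RELIEF lever; nothing here touches
`L(W^d, 1)`, C⁺, the crux `HeegnerTwistCouplingInSupply`, or BSD. No definition, no named fact, no `sorry`; axioms standard.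
[cite: Oesterle1985, §1.4 a) (p. 312)] [cite: Cox2013, §5.B Prop. 5.16, §7.B Thm. 7.7]
-/

noncomputable section

open scoped Classical NumberTheorySymbols nonZeroDivisors
open Module NumberField Ideal IsDedekindDomain
open Literature.NumberTheory.QuadraticFields Literature.NumberTheory.QuadraticFields.Quadratic

namespace Summit.BirchSwinnertonDyer.BirchSwinnertonDyer.Theorems.SplitPrimeOrder

variable {K : Type*} [Field K] [NumberField K]

/-! ## §1 Split data: two primes of norm `p` above `p` -/

omit [NumberField K] in
/-- A prime of `𝓞 K` containing the rational prime `p` lies above `(p) ⊂ ℤ`. [folklore] -/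
theorem mem_primesOver_of_natCast_mem [NumberField K] {p : ℕ} (hp : p.Prime) {Q : Ideal (𝓞 K)}
    (hQ : Q.IsPrime) (hpQ : (p : 𝓞 K) ∈ Q) : Q ∈ (span {(p : ℤ)}).primesOver (𝓞 K) := by
  haveI := hQ
  have hmax : (span {(p : ℤ)}).IsMaximal :=
    PrincipalIdealRing.isMaximal_of_irreducible (Nat.prime_iff_prime_int.mp hp).irreducible
  refine ⟨hQ, ⟨hmax.eq_of_le (Ideal.IsPrime.under ℤ Q).ne_top ?_⟩⟩
  rw [span_singleton_le_iff_mem, mem_comap, map_natCast]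
  exact hpQ

omit [NumberField K] in
/-- A prime above `(p)` contains `p`. [folklore] -/
theorem natCast_mem_of_mem_primesOver [NumberField K] {p : ℕ} {Q : Ideal (𝓞 K)}
    (hQ : Q ∈ (span {(p : ℤ)}).primesOver (𝓞 K)) : (p : 𝓞 K) ∈ Q := by
  have hover : span {(p : ℤ)} = Q.under ℤ := hQ.2.over
  have : (p : ℤ) ∈ Q.under ℤ := hover ▸ Ideal.mem_span_singleton_self (p : ℤ)
  have h' : ((p : ℤ) : 𝓞 K) ∈ Q := Ideal.mem_comap.mp this
  exact_mod_cast h'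

omit [NumberField K] in
/-- A prime of norm `p` is non-zero. [folklore] -/
theorem ne_bot_of_absNorm_eq_prime [NumberField K] {p : ℕ} (hp : p.Prime) {Q : Ideal (𝓞 K)}
    (hN : absNorm Q = p) : Q ≠ ⊥ := fun h => by
  rw [h, Ideal.absNorm_bot] at hN
  exact hp.ne_zero hN.symm

/-- **Split data at an odd prime**: for a quadratic field `K` and an odd prime `p` with `(d_K/p) = 1` there are exactly
two primes of `𝓞 K` above `p`, each of absolute norm `p` (Dedekind–Kummer on `X² − tX − m`; extracted from the tree's
proof of `natAbs_discr_le_four_mul_pow_classNumber`). [cite: Cox2013, §5.B Prop. 5.16] -/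
theorem splitData_of_jacobiSym (h2 : finrank ℚ K = 2) {p : ℕ} (hp : p.Prime) (hp2 : p ≠ 2)
    (hJ : J(NumberField.discr K | p) = 1) :
    ((span {(p : ℤ)}).primesOver (𝓞 K)).ncard = 2 ∧
      ∀ P ∈ (span {(p : ℤ)}).primesOver (𝓞 K), absNorm P = p := by
  haveI := Fact.mk hp
  haveI : NeZero (2 : ZMod p) := ⟨two_ne_zero_zmod hp2⟩
  obtain ⟨b, hb⟩ := exists_basis_zero_eq_one h2
  set D := NumberField.discr K with hDdef
  have hD : D = (b.repr (b 1 * b 1) 1) ^ 2 + 4 * b.repr (b 1 * b 1) 0 :=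
    discr_eq_sq_add_four_mul b hb
  refine ⟨(ncard_primesOver_eq_two_iff_jacobiSym h2 hp hp2).mpr hJ, fun P hP => ?_⟩
  have hleg : legendreSym p D = 1 := by rwa [← jacobiSym.legendreSym.to_jacobiSym] at hJ
  have h0 : ((D : ℤ) : ZMod p) ≠ 0 := by
    intro h
    rw [(legendreSym.eq_zero_iff p D).mpr h] at hleg
    exact zero_ne_one hleg
  obtain ⟨r, hr⟩ := (legendreSym.eq_one_iff p h0).mp hleg
  have hcast : (((b.repr (b 1 * b 1) 1) ^ 2 + 4 * b.repr (b 1 * b 1) 0 : ℤ) : ZMod p) =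
      ((b.repr (b 1 * b 1) 1 : ℤ) : ZMod p) ^ 2 + 4 * ((b.repr (b 1 * b 1) 0 : ℤ) : ZMod p) := by
    push_cast; ring
  have hs : r ^ 2 = ((b.repr (b 1 * b 1) 1 : ℤ) : ZMod p) ^ 2 +
      4 * ((b.repr (b 1 * b 1) 0 : ℤ) : ZMod p) := by
    rw [← hcast, ← hD, hr, sq]
  have := absNorm_eq_pow_of_forall_natDegree_eq b hb (d := 1)
    (fun Q hQ => natDegree_eq_one_of_mem_of_sq_eq hs hQ) hP
  rw [this, pow_one]

/-- **Split data at `2`**: for a quadratic field `K` with `d_K ≡ 1 (mod 8)` there are exactly two primes above `2`,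
each of absolute norm `2` (`X² − tX − m ≡ X(X − 1) (mod 2)`; extracted from the tree's proof of
`natAbs_discr_le_four_mul_two_pow_classNumber`). [cite: Cox2013, §5.B Prop. 5.16] -/
theorem splitData_two (h2 : finrank ℚ K = 2) (h8 : NumberField.discr K % 8 = 1) :
    ((span {((2 : ℕ) : ℤ)}).primesOver (𝓞 K)).ncard = 2 ∧
      ∀ P ∈ (span {((2 : ℕ) : ℤ)}).primesOver (𝓞 K), absNorm P = 2 := by
  haveI := Fact.mk Nat.prime_two
  obtain ⟨b, hb⟩ := exists_basis_zero_eq_one h2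
  have hD : NumberField.discr K = (b.repr (b 1 * b 1) 1) ^ 2 + 4 * b.repr (b 1 * b 1) 0 :=
    discr_eq_sq_add_four_mul b hb
  set t : ℤ := b.repr (b 1 * b 1) 1 with ht
  set m : ℤ := b.repr (b 1 * b 1) 0 with hm
  have hcount : ((span {(2 : ℤ)}).primesOver (𝓞 K)).ncard = 2 :=
    (ncard_primesOver_two_eq_two_iff h2).mpr h8
  -- `t` is odd and `m` is even
  have htodd : Odd t := by
    rcases Int.even_or_odd t with ⟨k, hk⟩ | hodd
    · exfalso
      have : NumberField.discr K = 4 * (k ^ 2 + m) := by rw [hD, hk]; ring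
      omega
    · exact hodd
  obtain ⟨k, hk⟩ := htodd
  have hmeven : Even m := by
    obtain ⟨i, hi⟩ := Int.even_mul_succ_self k
    have : NumberField.discr K = 8 * i + 1 + 4 * m := by
      rw [hD, hk]; linear_combination 4 * hi
    refine ⟨m / 2, ?_⟩
    omega
  obtain ⟨j, hj⟩ := hmeven
  have h1 : ((t : ℤ) : ZMod 2) = 1 := by
    rw [hk, Int.cast_add, Int.cast_mul, Int.cast_ofNat, show (2 : ZMod 2) = 0 from rfl, zero_mul,
      zero_add, Int.cast_one]
  have h0 : ((m : ℤ) : ZMod 2) = 0 := by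
    rw [hj, show j + j = 2 * j by ring, Int.cast_mul, Int.cast_ofNat,
      show (2 : ZMod 2) = 0 from rfl, zero_mul]
  have hnorm : ∀ P ∈ (span {((2 : ℕ) : ℤ)}).primesOver (𝓞 K), absNorm P = 2 := fun P hP => by
    have := absNorm_eq_pow_of_forall_natDegree_eq b hb (p := 2) (d := 1) (fun Q hQ => by
      rw [← ht, ← hm, h1, h0] at hQ
      exact natDegree_eq_one_of_mem_one_zero hQ) hP
    rw [this, pow_one]
  have hcount' : ((span {((2 : ℕ) : ℤ)}).primesOver (𝓞 K)).ncard = 2 := by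
    rw [Nat.cast_ofNat]; exact hcount
  exact ⟨hcount', hnorm⟩

/-! ## §2 Ideals of prime-power norm at a split prime -/

omit [NumberField K] in
/-- **Every ideal of norm `p^e` is `𝔭^i 𝔭'^j` with `i + j = e`** when the primes above `p` are `𝔭, 𝔭'`, both of norm
`p`: a maximal ideal above an ideal of norm `p^e`, `e ≥ 1`, contains `p`, so it lies above `(p)` and is `𝔭` or `𝔭'`,
and it divides the ideal; induct (abstract form of `Quadratic.exists_eq_pow_mul_pow_of_absNorm_eq`).
[cite: Cox2013, §7.B Thm. 7.7] -/
theorem exists_eq_pow_mul_pow_of_absNorm_eq_pow [NumberField K] {p : ℕ} (hp : p.Prime)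
    {P P' : Ideal (𝓞 K)} (hPP' : (span {(p : ℤ)}).primesOver (𝓞 K) = {P, P'})
    (hNP : absNorm P = p) (hNP' : absNorm P' = p) {e : ℕ} {I : Ideal (𝓞 K)} (hI : absNorm I = p ^ e) :
    ∃ i j : ℕ, i + j = e ∧ I = P ^ i * P' ^ j := by
  induction e generalizing I with
  | zero =>
    refine ⟨0, 0, rfl, ?_⟩
    rw [pow_zero] at hI
    rw [absNorm_eq_one_iff.1 hI, pow_zero, pow_zero, one_mul, one_eq_top]
  | succ e ih =>
    have hItop : I ≠ ⊤ := by
      rintro rfl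
      rw [absNorm_top] at hI
      have : 1 < p ^ (e + 1) := Nat.one_lt_pow (Nat.succ_ne_zero e) hp.one_lt
      omega
    obtain ⟨M, hMmax, hIM⟩ := exists_le_maximal I hItop
    have hpM : (p : 𝓞 K) ∈ M := by
      have h1 : ((absNorm I : ℕ) : 𝓞 K) ∈ M := hIM (absNorm_mem I)
      rw [hI, Nat.cast_pow] at h1
      exact hMmax.isPrime.mem_of_pow_mem _ h1
    have hMmem : M ∈ (span {(p : ℤ)}).primesOver (𝓞 K) :=
      mem_primesOver_of_natCast_mem hp hMmax.isPrime hpM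
    rw [hPP'] at hMmem
    obtain ⟨J, hJ⟩ := Ideal.dvd_iff_le.2 hIM
    have hJn : ∀ (_ : absNorm M = p), absNorm J = p ^ e := fun hMn => by
      have h := congrArg absNorm hJ
      rw [map_mul, hI, hMn, pow_succ'] at h
      exact (Nat.eq_of_mul_eq_mul_left hp.pos h).symm
    rcases hMmem with hM | hM
    · obtain ⟨i, j, hij, hJeq⟩ := ih (hJn (hM ▸ hNP))
      refine ⟨i + 1, j, by omega, ?_⟩
      rw [hJ, hJeq, hM]
      ring
    · have hM' : M = P' := hM
      obtain ⟨i, j, hij, hJeq⟩ := ih (hJn (hM' ▸ hNP'))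
      refine ⟨i, j + 1, by omega, ?_⟩
      rw [hJ, hJeq, hM']
      ring

/-- **`(p) = 𝔭𝔭'` at a split prime**: the ideal `(p)` has norm `p²`, so it is `𝔭^i 𝔭'^j` with `i + j = 2`, and
`𝔭² = (p) ⊆ 𝔭'` (or symmetrically) would force `𝔭 = 𝔭'`. [cite: Cox2013, §5.B Prop. 5.16] -/
theorem span_natCast_eq_mul (h2 : finrank ℚ K = 2) {p : ℕ} (hp : p.Prime)
    {P P' : Ideal (𝓞 K)} (hne : P ≠ P') (hPP' : (span {(p : ℤ)}).primesOver (𝓞 K) = {P, P'})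
    (hNP : absNorm P = p) (hNP' : absNorm P' = p) :
    span {(p : 𝓞 K)} = P * P' := by
  have hP : P ∈ (span {(p : ℤ)}).primesOver (𝓞 K) := by rw [hPP']; exact Set.mem_insert _ _
  have hP' : P' ∈ (span {(p : ℤ)}).primesOver (𝓞 K) := by
    rw [hPP']; exact Set.mem_insert_of_mem _ (Set.mem_singleton _)
  haveI hPprime : P.IsPrime := hP.1
  haveI hP'prime : P'.IsPrime := hP'.1
  have hNp : absNorm (span {(p : 𝓞 K)}) = p ^ 2 := by
    rw [Ideal.absNorm_span_natCast, RingOfIntegers.rank, h2]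
  obtain ⟨i, j, hij, heq⟩ := exists_eq_pow_mul_pow_of_absNorm_eq_pow hp hPP' hNP hNP' hNp
  have hpP : (p : 𝓞 K) ∈ P := natCast_mem_of_mem_primesOver hP
  have hpP' : (p : 𝓞 K) ∈ P' := natCast_mem_of_mem_primesOver hP'
  have hmaxP : P.IsMaximal := hPprime.isMaximal (ne_bot_of_absNorm_eq_prime hp hNP)
  have hmaxP' : P'.IsMaximal := hP'prime.isMaximal (ne_bot_of_absNorm_eq_prime hp hNP')
  -- exclude `(i, j) = (2, 0)` and `(0, 2)`
  rcases Nat.lt_or_ge 0 i with hi | hi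
  · rcases Nat.lt_or_ge 0 j with hj | hj
    · obtain ⟨rfl, rfl⟩ : i = 1 ∧ j = 1 := by omega
      rw [heq, pow_one, pow_one]
    · exfalso
      obtain ⟨rfl, rfl⟩ : i = 2 ∧ j = 0 := by omega
      rw [pow_zero, mul_one] at heq
      have hle : P ^ 2 ≤ P' := by
        rw [← heq, span_singleton_le_iff_mem]
        exact hpP'
      have hle' : P ≤ P' := (Ideal.IsPrime.pow_le_iff (by norm_num)).mp hle
      exact hne (hmaxP.eq_of_le hP'prime.ne_top hle')
  · exfalso
    obtain ⟨rfl, rfl⟩ : i = 0 ∧ j = 2 := by omega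
    rw [pow_zero, one_mul] at heq
    have hle : P' ^ 2 ≤ P := by
      rw [← heq, span_singleton_le_iff_mem]
      exact hpP
    have hle' : P' ≤ P := (Ideal.IsPrime.pow_le_iff (by norm_num)).mp hle
    exact hne (hmaxP'.eq_of_le hPprime.ne_top hle').symm

/-! ## §3 A primitive element of prime-power norm generates a pure prime power -/

/-- ★ **`|N(π)| = pⁿ` and `π ∉ p𝓞_K` force `(π) = 𝔭ⁿ` for ONE prime `𝔭 ∣ p`** (`p` split in the quadratic field
`K`): `(π) = 𝔭^i 𝔭'^j` with `i + j = n`, and `i, j ≥ 1` would give `(p) = 𝔭𝔭' ∣ (π)`, i.e. `π ∈ p𝓞_K`.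
[cite: Cox2013, §7.B Thm. 7.7] -/
theorem exists_span_singleton_eq_pow (h2 : finrank ℚ K = 2) {p : ℕ} (hp : p.Prime)
    (hcount : ((span {(p : ℤ)}).primesOver (𝓞 K)).ncard = 2)
    (hnorm : ∀ P ∈ (span {(p : ℤ)}).primesOver (𝓞 K), absNorm P = p)
    {π : 𝓞 K} {n : ℕ} (hNπ : (Algebra.norm ℤ π).natAbs = p ^ n)
    (hπp : π ∉ span {(p : 𝓞 K)}) :
    ∃ P ∈ (span {(p : ℤ)}).primesOver (𝓞 K), span {π} = P ^ n := by
  obtain ⟨P, P', hne, hPP'⟩ := Set.ncard_eq_two.mp hcount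
  have hP : P ∈ (span {(p : ℤ)}).primesOver (𝓞 K) := by rw [hPP']; exact Set.mem_insert _ _
  have hP' : P' ∈ (span {(p : ℤ)}).primesOver (𝓞 K) := by
    rw [hPP']; exact Set.mem_insert_of_mem _ (Set.mem_singleton _)
  have hNP : absNorm P = p := hnorm P hP
  have hNP' : absNorm P' = p := hnorm P' hP'
  have hI : absNorm (span {π}) = p ^ n := by rw [Ideal.absNorm_span_singleton, hNπ]
  obtain ⟨i, j, hij, heq⟩ := exists_eq_pow_mul_pow_of_absNorm_eq_pow hp hPP' hNP hNP' hI
  rcases Nat.eq_zero_or_pos i with hi | hi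
  · subst hi
    refine ⟨P', hP', ?_⟩
    rw [heq, pow_zero, one_mul, show j = n by omega]
  rcases Nat.eq_zero_or_pos j with hj | hj
  · subst hj
    refine ⟨P, hP, ?_⟩
    rw [heq, pow_zero, mul_one, show i = n by omega]
  -- both exponents positive: `(p) = PP' ∣ (π)`
  exfalso
  have hdvd : P * P' ∣ span {π} := by
    rw [heq]
    exact mul_dvd_mul (dvd_pow_self P hi.ne') (dvd_pow_self P' hj.ne')
  rw [← span_natCast_eq_mul h2 hp hne hPP' hNP hNP', Ideal.dvd_iff_le, span_singleton_le_iff_mem] at hdvd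
  exact hπp hdvd

/-- **`ord[𝔭] ∣ n` when `(π) = 𝔭ⁿ`**: the class of `𝔭` is killed by `n`. [folklore] -/
theorem orderOf_dvd_of_span_singleton_eq_pow {P : Ideal (𝓞 K)} (hP0 : P ∈ (Ideal (𝓞 K))⁰)
    {π : 𝓞 K} {n : ℕ} (heq : span {π} = P ^ n) :
    orderOf (ClassGroup.mk0 ⟨P, hP0⟩) ∣ n := by
  refine orderOf_dvd_of_pow_eq_one ?_
  have hPn0 : P ^ n ∈ (Ideal (𝓞 K))⁰ := pow_mem hP0 n
  have hmk : ClassGroup.mk0 (⟨P, hP0⟩ : (Ideal (𝓞 K))⁰) ^ n = ClassGroup.mk0 ⟨P ^ n, hPn0⟩ := by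
    rw [← map_pow]
    rfl
  rw [hmk, ClassGroup.mk0_eq_one_iff]
  rw [← heq]
  exact ⟨⟨π, rfl⟩⟩

end Summit.BirchSwinnertonDyer.BirchSwinnertonDyer.Theorems.SplitPrimeOrder

end
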